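/-
Copyright: public-audit package `pub-balaban` (b2b-balaban), seat pv09-g5. Released under Apache 2.0 like Mathlib.
-/
import Literature.MathematicalPhysics.QuantumFieldTheory.Balaban1983to89.B6Lemma24Torus
import Literature.MathematicalPhysics.QuantumFieldTheory.Balaban1983to89.B5Bounds167Lattice

/-!
# B6 (2.153) on the whole torus T^(k) for the CONCRETE objects of the package: the (1.66) form and Lemma 2.4 on T

Source under audit: T. Bałaban, *Propagators and renormalization transformations for lattice gauge theories.
II*, Commun. Math. Phys. **96** (1984) 223–250 [B6], (2.152)–(2.153) p. 249, (2.118) p. 243; and *… I*, Commun.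
Math. Phys. **95** (1984) 17–40 [B5], (1.65)–(1.67) p. 29.  Quotations read by this seat from the ×2 page renders
`run/shared/lean/pub/pub-balaban/b2b-balaban-ref1/pages/1984-cmp96-propagators-rt-II/…-p021-x2.png` (p. 243),
`…-p027-x2.png` (p. 249) (journal page = PDF page + 222) and `…/1984-cmp95-propagators-rt-I/…-p013-x2.png`
(B5 p. 29; journal page = PDF page + 16), not from an OCR layer.

CITATION HEADER (lean-in-tree rule).  Cell `pub-balaban`, unit `b2b-balaban-pv09-g5` (surge node prover #09,
gen 5; journal claim G-B6-2153-TORUS, self-assigned under the yield clause).  Siblings imported, none edited: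
`…B6Lemma24Torus` (this lineage, gen 5: Lemma 2.4 (2.128) with the printed constant on the torus, `lemma24_torus`;
the torus carriers `torusCarrier`; the periodic-configuration model `IsPeriodic`, `pbox`, `normSqT`, `d1SqT`,
`q1SqT`, `faces`, `coarseSites`) and `…B5Bounds167Lattice` (pv15 lineage: the unit torus `Tor M = Π_μ ℤ/M_μ` of
`…B5Prop11Plancherel`, the form `formDk n M` = THIRD EXPRESSION of (1.66), `d1Sq` = ⟨∂₁B, ∂₁B⟩, and (1.67) for them
as the THEOREM `ineq167` with γ₀ = (4/π²)^{d+2}); through them `B6` (`LowerBound2153`), `B6TreeGaugePoincare`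
(`Cfg`, `curl`), `B6BondElimination` (`unitVec`, `treeBonds`), `B6Lemma24PrintedShape` (`q1`, `contourSum`).

## What is printed (verbatim)

* [B6] p. 249, the use-site: *"Next let us consider the inequality (2.128) in Lemma 2.4 again. We will apply it in
  the following situation. Doing a k + 1 renormalization transformation we have to calculate an integral of the
  form  const ∫dB δ(QB) δ_{Ax}(B) e^{−½⟨B,Δ_kB⟩} F(B)  (1.152) [sic: (2.152)]  on the whole lattice T^{(k)}, or on a
  subset Λ ⊂ T^{(k)}. Using (2.118) and (2.128) we get  ⟨B, Δ_kB⟩ ≥ (γ₀/(12d²)) L^{−d−1} ‖B‖²,  or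
  Δ_k ≥ (γ₀/(12d²)) L^{−d−1}  (2.153)  on the subspace of B satisfying: QB = 0, B(Γ_{y,x}) = 0 for x ∈ B(y)."*
  (v1/v1.1 of this header carried a NON-verbatim rendering of this passage, typed from memory; corrected in v1.2 —
  journal CORRECTION line of this seat, 2026-08-19.)
* [B6] p. 243: *"Thus both factors are equal and in fact the quadratic forms are equal to ⟨B, Δ_jB⟩ given by (1.66)
  and satisfying (1.67):  γ₀‖∂₁B‖² ≤ ⟨B, Δ_jB⟩ ≤ γ₁‖∂₁B‖².  (2.118)"* (the series' restatement of B5 (1.67)).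
* [B6] p. 245, Lemma 2.4's conventions: *"Let a set Λ ⊂ Z^d be a sum of blocks, Λ = B(Λ′). We denote by Λ also a set
  of bonds b such that at least one of the end-points b₋, b₊ belongs to Λ. … We put B = 0 outside Λ."*
* [B5] p. 29: *"The action Δ_k is thus defined by ⟨B, Δ_kB⟩ = ⟨∂H_kB, ∂H_kB⟩. (1.65) Using formulas (1.60) or
  (1.63) we obtain the following expression ⟨B, Δ_kB⟩ = ½Σ_{μ,ν}⟨(∂¹_μB_ν − ∂¹_νB_μ), …⟩ = ⟨∂₁B, σ_k∂₁B⟩ =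
  ½Σ_{μ,ν}(2π)^{−d}∫dp′ (…) |(∂₁B)~_{μν}(p′)|². (1.66) The function under the integral is bounded from below and
  above by positive constants γ₀, γ₁ dependent on d only, so we have γ₀⟨∂₁B, ∂₁B⟩ ≤ ⟨B, Δ_kB⟩ ≤ γ₁⟨∂₁B, ∂₁B⟩.
  (1.67)"*

## What this file proves (kernel-checked, no `sorry`; nothing printed is asserted without proof)

The p. 249 passage *"Using (2.118) and (2.128) we get … (2.153)"* — in BOTH printed cases, *"on the whole lattice
T^{(k)}"* (§§4–6) and *"or on a subset Λ ⊂ T^{(k)}"* (§7, v1.2) — as a THEOREM of the package for the two CONCRETE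
objects the tree already holds, joined by an explicit dictionary:

* the DICTIONARY (§§1–3) between the two typings of "a configuration on the torus T" present in the tree —
  (a) `…B6Lemma24Torus`: an M-periodic configuration `B : Cfg d` on the unit bonds of Z^d, sums over the base
  points of the box Π_i[0, M_i) (`normSqT`, `d1SqT`, `q1SqT`); (b) `…B5Bounds167Lattice`: a real vector field
  `B : Tor M × Fin d → ℝ` on `Tor M = Π_μ ZMod (M μ)` read in ℂ (`ofRealCfg`), with `d1Sq M` = ½Σ_{μ,ν}Σ_x
  |(∂¹_μB_ν − ∂¹_νB_μ)(x)|².  `lift M B` (Z^d-periodic extension, `isPeriodic_lift`) and `restrict M B` (box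
  representatives, `lift_restrict`) are inverse to each other on periodic configurations; the box is in bijection
  with `Tor M` (`sum_pbox_toT`); the plaquette variable `B6TreeGaugePoincare.curl` of the lift IS B5's
  `∂¹_jB_μ − ∂¹_μB_j` at the residue class (`curl_lift`, same sign convention); hence
  `d1SqT M (lift M B) = B5Bounds167Lattice.d1Sq M (ofRealCfg M B)` (`d1SqT_lift`: the once-each plaquette sum
  Σ_{j<μ} equals the printed ½Σ_{μ,ν} over ordered pairs, `half_sum_offDiag`) and
  `normSqT M (lift M B) = Σ_x Σ_ν B(x,ν)²` (`normSqT_lift`);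
* `lowerBound2153_lattice` (§4): for every d ≥ 2, L ≥ 1, n ≥ 1 (n = L^k fine points per unit length enters only
  the weight of (1.66)), every torus `M` with `NeZero (M μ)` and L ∣ M_μ, and every real vector field B on `Tor M`
  in the gauge (2.121) on the blocks of T′ with (Q₁B)(c) = 0 at every coarse bond c of T:
  ((4/π²)^{d+2}/(12d²)) · L^{−(d+1)} · Σ_x Σ_ν B(x,ν)² ≤ `formDk n M (ofRealCfg M B)` — i.e. (2.153) with
  γ₀ = the package's (1.67) constant, from `B6Lemma24Torus.lemma24_torus` (p182680) and
  `B5Bounds167Lattice.ineq167` BY NAME; `lowerBound2153_lattice_contour` takes (2.121) in its printed contour form;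
* the TYPED NODE `B6.LowerBound2153 d L ((4/π²)^{d+2}) (torus carriers) (formT) QZero` (§5,
  `lowerBound2153_torusCarrier`, `…_faces`, `…_faces18`) where `formT n M B := formDk n M (ofRealCfg M (restrict M B))`
  is the (1.66) form of the torus configuration B — with NO (2.118) hypothesis: for these carriers (2.118) is the
  theorem `formT_ge` (= `ineq167` through the dictionary).  This answers advisory A1 of the cross-read of
  `…B6Lemma24Torus` (cell REFEREE6 E101: its `lowerBound2153_torus` takes (2.118) as a hypothesis on all
  configurations) by discharging the hypothesis for the concrete form.
* v1.1 (append-only, §6): the SAME two typed nodes stated on B5's OWN configuration type — `torCarrier L M :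
  B6.TreeData` with `Cfg := Tor M × Fin d → ℝ` (literally the configuration type of
  `B5Bounds167Lattice.formOfLatticeR n M`, `torCarrier_cfg`), TreeGauge = (2.121) on T′ for the periodic extension,
  `d1Sq := B5Bounds167Lattice.d1Sq M (ofRealCfg M B)`, `normSq := Σ_x Σ_ν B(x,ν)²`: `lemma24Printed_tor :
  B6.Lemma24Printed d L (fun i => torCarrier L (M i))` and `lowerBound2153_tor : B6.LowerBound2153 d L ((4/π²)^{d+2})
  (fun i => torCarrier L (M i)) (fun i B => (formOfLatticeR (n i) (M i)).formΔk B) QZero` — the Lemma-2.4 and (2.153)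
  leaves on the same carriers as the (1.67) leaf `B5Bounds167Lattice.bounds167_formOfLatticeR`, so that a binding
  can take both without the lift/restrict dictionary (here (2.118) holds for EVERY configuration of the carrier, and
  `B6.lowerBound2153_of_lemma24` applies verbatim).
* v1.2 (append-only, §7; + the header's quotation corrections): the case *"or on a subset Λ ⊂ T^{(k)}"* of the same
  p. 249 passage, in the reading of HONEST SCOPE (ii) — `lemma24_torus_subset` ((2.128) on T for B = 0 outside
  Λ = B(Λ′₀), gauge (2.121) on the blocks of Λ′₀ only, Q₁-sum over the coarse bonds meeting Λ′₀: a COROLLARY of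
  `lemma24_torus`, since the other blocks are in the gauge automatically and the other Q₁-terms vanish),
  `lowerBound2153_lattice_subset` ((2.153) for the (1.66) form at such B), and the typed nodes
  `lemma24Printed_torSub` / `lowerBound2153_torSub(_faces)` for the carriers `torCarrierSub L M Λ′₀` (TreeGauge :=
  support condition ∧ (2.121) on Λ′₀) with B5's own form; `facesOf_univ`: Λ′₀ ⊇ T′ gives back the whole-torus case.

## HONEST SCOPE (what is NOT claimed)

(i) `formDk` is ⟨B, Δ_kB⟩ AS GIVEN BY THE THIRD EXPRESSION OF (1.66) (torus momentum sum with the unitary DFT);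
that this quadratic form IS (1.65) ⟨∂H_kB, ∂H_kB⟩ for the minimiser H_kB of (1.59)/(1.60) is NOT certified in the
kernel for these concrete objects (`…B5Bounds167Lattice` header, «What is NOT claimed» (1); the cell holds (1.66)
by hand and numerically) — so "Δ_k ≥ …" is certified for the (1.66)-form, and for the operator Δ_k of (1.65) only
relative to that identity.  (ii) The case *"or on a subset Λ ⊂ T^{(k)}"* (§7) is READ as follows: Λ = B(Λ′₀) for a
set Λ′₀ ⊆ T′ of coarse sites, B ranges over the configurations on T with *"B = 0 outside Λ"* in Lemma 2.4's bond
convention (B(b) = 0 unless b₋ or b₊ lies in Λ; sites of T compared through their box representatives), the form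
is the SAME torus form ⟨B, Δ_kB⟩ of (1.66) evaluated at such B (the variables B↾Λ of (2.154)), and the constraints
are (2.121) on the blocks B(y), y ∈ Λ′₀, and (Q₁B)(c) = 0 on the coarse bonds c of T with c₋ or c₊ in Λ′₀; any
other meaning of "on a subset Λ" (e.g. a differently defined restricted operator) is NOT addressed.  v1/v1.1 of
this file did not treat the subset case at all.
(iii) γ₀ = (4/π²)^{d+2} is the PACKAGE's constant (the print attributes no value); d ≥ 2 (for d = 1 there are no
plaquettes).  (iv) The constraint "QB = 0" is read as (Q₁B)(c) = 0 with Q₁ verbatim from (2.125)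
(`B6Lemma24PrintedShape.q1`), equivalently the B5 (1.8) three-contour average (`…_faces18`, via
`B6Lemma24Torus.q18_eq_q1_torus`); "B(Γ_{y,x}) = 0" as the tree gauge (2.121) on the blocks B(y), y ∈ T′, stated on
the periodic extension `lift M B` (every bond of Γ_{y,x}, x ∈ B(y), y ∈ T′ lies in the box, so this is a condition
on B itself).
-/

open Finset

namespace Literature.MathematicalPhysics.QuantumFieldTheory.Balaban1983to89.B6LowerBound2153Torus

open B6BondElimination (unitVec unitVec_apply treeBonds)
open B6TreeGaugePoincare (Cfg curl)
open B6Lemma24PrintedShape (q1 q18 contourSum treeGauge_of_contour)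
open B6Lemma24Torus (IsPeriod IsPeriodic pbox mem_pbox bondsT plaqT normSqT d1SqT q1SqT coarseSites faces
  torusCarrier lemma24_torus lemma24_torus_contour q18_eq_q1_torus)
open B5Prop11Plancherel (Tor shiftM fdiff)
open B5Bounds167Lattice (ofRealCfg formDk ineq167)
open B6 (TreeData LowerBound2153)

noncomputable section

variable {d : ℕ} (M : Fin d → ℕ) [hM : ∀ μ, NeZero (M μ)]

/-! ## §1  The box Π[0, M_μ) ⊂ Z^d and the torus `Tor M = Π_μ ZMod (M μ)` -/

/-- The residue class x mod M of a point of Z^d: the quotient map Z^d → T. [folklore] -/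
def toT (x : Fin d → ℤ) : Tor M := fun i => (x i : ZMod (M i))

/-- The box representative of a residue class (coordinates in [0, M_μ)). [folklore] -/
def rep (t : Tor M) : Fin d → ℤ := fun i => ((t i).val : ℤ)

omit hM in
/-- The quotient map is additive. [folklore] -/
theorem toT_add (x v : Fin d → ℤ) : toT M (x + v) = toT M x + toT M v := by
  ext i; simp [toT]

omit hM in
/-- Periods go to 0. [folklore] -/
theorem toT_period {v : Fin d → ℤ} (hv : IsPeriod M v) : toT M v = 0 := by
  ext i
  simp only [toT, Pi.zero_apply]
  exact (ZMod.intCast_zmod_eq_zero_iff_dvd (v i) (M i)).2 (hv i)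

omit hM in
/-- The unit vector e_j of Z^d goes to the unit vector of the torus (`B5Prop11Plancherel.unitVec`). [folklore] -/
theorem toT_unitVec (j : Fin d) : toT M (unitVec j) = B5Prop11Plancherel.unitVec M j := by
  ext i
  by_cases h : i = j
  · subst h; simp [toT, unitVec_apply, B5Prop11Plancherel.unitVec]
  · simp [toT, unitVec_apply, B5Prop11Plancherel.unitVec, h]

/-- The representative lies in the box. [folklore] -/
theorem rep_mem_pbox (t : Tor M) : rep M t ∈ pbox M :=
  mem_pbox.2 fun i => by
    simp only [rep]
    exact ⟨Int.natCast_nonneg _, by exact_mod_cast ZMod.val_lt (t i)⟩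

/-- rep is a section of the quotient map. [folklore] -/
theorem toT_rep (t : Tor M) : toT M (rep M t) = t := by
  ext i; simp [toT, rep]

/-- On the box the quotient map is inverted by rep. [folklore] -/
theorem rep_toT {x : Fin d → ℤ} (hx : x ∈ pbox M) : rep M (toT M x) = x := by
  ext i
  obtain ⟨h0, h1⟩ := mem_pbox.1 hx i
  simp only [rep, toT, ZMod.val_intCast]
  exact Int.emod_eq_of_lt h0 h1

omit hM in
/-- rep (x mod M) − x is a period. [folklore] -/
theorem isPeriod_rep_toT_sub [∀ μ, NeZero (M μ)] (x : Fin d → ℤ) : IsPeriod M (rep M (toT M x) - x) := fun i => by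
  simp only [Pi.sub_apply, rep, toT, ZMod.val_intCast]
  exact ⟨-(x i / (M i : ℤ)), by rw [Int.emod_def]; ring⟩

/-- **The box is a system of representatives of the torus**: Σ_{x ∈ Π[0,M_μ)} g(x mod M) = Σ_{t ∈ T} g(t). [folklore] -/
theorem sum_pbox_toT (g : Tor M → ℝ) : ∑ x ∈ pbox M, g (toT M x) = ∑ t : Tor M, g t :=
  sum_nbij' (fun x => toT M x) (fun t => rep M t) (fun _ _ => mem_univ _) (fun t _ => rep_mem_pbox M t)
    (fun _ hx => rep_toT M hx) (fun t _ => toT_rep M t) fun _ _ => rfl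

/-! ## §2  Periodic configurations on Z^d ↔ vector fields on the torus -/

/-- The Z^d-periodic extension of a real vector field on the torus: (lift B)(⟨x, x + e_ν⟩) = B_ν(x mod M). [folklore] -/
def lift (B : Tor M × Fin d → ℝ) : Cfg d := fun b => B (toT M b.1, b.2)

/-- The field on the torus read off a configuration on Z^d through the box representatives. [folklore] -/
def restrict (B : Cfg d) : Tor M × Fin d → ℝ := fun p => B (rep M p.1, p.2)

omit hM in
/-- Evaluation of the lift. [folklore] -/
theorem lift_apply (B : Tor M × Fin d → ℝ) (x : Fin d → ℤ) (ν : Fin d) : lift M B (x, ν) = B (toT M x, ν) := rfl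

omit hM in
/-- The lift is M-periodic (a configuration on T in the sense of `B6Lemma24Torus`). [folklore] -/
theorem isPeriodic_lift (B : Tor M × Fin d → ℝ) : IsPeriodic M (lift M B) := by
  intro x v ν hv
  simp only [lift_apply, toT_add, toT_period M hv, add_zero]

/-- restrict ∘ lift = id. [folklore] -/
theorem restrict_lift (B : Tor M × Fin d → ℝ) : restrict M (lift M B) = B := by
  funext p
  simp only [restrict, lift_apply, toT_rep]

/-- lift ∘ restrict = id on periodic configurations. [folklore] -/
theorem lift_restrict {B : Cfg d} (hB : IsPeriodic M B) : lift M (restrict M B) = B := by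
  funext b
  obtain ⟨x, ν⟩ := b
  simp only [lift_apply, restrict]
  have h := hB x (rep M (toT M x) - x) ν (isPeriod_rep_toT_sub M x)
  rwa [add_sub_cancel] at h

/-! ## §3  The dictionary for ∂₁B and ‖B‖² -/

/-- **Same plaquette variable.**  B5's `(∂¹_jB_μ − ∂¹_μB_j)(x mod M)` (`B5Bounds167Lattice.curl`, forward differences
on the torus) is the circulation `B6TreeGaugePoincare.curl` of the periodic extension around the plaquette with
lowest corner x spanned by (e_j, e_μ) — B⟨x,x+e_j⟩ + B⟨x+e_j,x+e_j+e_μ⟩ − B⟨x+e_μ,x+e_μ+e_j⟩ − B⟨x,x+e_μ⟩, same sign.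
[cite: Balaban1984PropagatorsI, (1.4) p.18, (1.66) p.29; dictionary] -/
theorem curl_lift (B : Tor M × Fin d → ℝ) (x : Fin d → ℤ) (j μ : Fin d) :
    B5Bounds167Lattice.curl M (ofRealCfg M B) j μ (toT M x) = ((curl (lift M B) x j μ : ℝ) : ℂ) := by
  have hshift : ∀ (ν κ : Fin d) (y : Tor M) (A : Tor M × Fin d → ℂ),
      (shiftM M ν).mulVec A (y, κ) = A (y + B5Prop11Plancherel.unitVec M ν, κ) := by
    intro ν κ y A
    simp [Matrix.mulVec, dotProduct, shiftM]
  simp only [B5Bounds167Lattice.curl, fdiff, one_smul, Matrix.sub_mulVec, Matrix.one_mulVec, Pi.sub_apply,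
    hshift, ofRealCfg, curl, lift_apply, toT_add, toT_unitVec]
  push_cast
  ring

/-- |(∂¹_jB_μ − ∂¹_μB_j)(x mod M)|² = (∂₁(lift B))(p)² for the plaquette p at x spanned by (e_j, e_μ). [folklore] -/
theorem norm_sq_curl_lift (B : Tor M × Fin d → ℝ) (x : Fin d → ℤ) (j μ : Fin d) :
    ‖B5Bounds167Lattice.curl M (ofRealCfg M B) j μ (toT M x)‖ ^ 2 = curl (lift M B) x j μ ^ 2 := by
  rw [curl_lift, Complex.norm_real, Real.norm_eq_abs, sq_abs]

omit hM in
/-- ½Σ_{μ,ν} over ORDERED pairs of a symmetric table with zero diagonal = Σ_{μ<ν} (the printed ½Σ_{μ,ν} of (1.66)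
versus a once-each plaquette sum). [folklore] -/
theorem half_sum_offDiag (g : Fin d → Fin d → ℝ) (hs : ∀ μ ν, g μ ν = g ν μ) (h0 : ∀ μ, g μ μ = 0) :
    1 / 2 * ∑ μ, ∑ ν, g μ ν = ∑ μ, ∑ ν, if μ < ν then g μ ν else 0 := by
  have hsplit : ∑ μ, ∑ ν, g μ ν
      = (∑ μ, ∑ ν, if μ < ν then g μ ν else 0) + ∑ μ, ∑ ν, if ν < μ then g μ ν else 0 := by
    rw [← sum_add_distrib]
    refine sum_congr rfl fun μ _ => ?_
    rw [← sum_add_distrib]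
    refine sum_congr rfl fun ν _ => ?_
    rcases lt_trichotomy μ ν with h | h | h
    · rw [if_pos h, if_neg (not_lt.2 h.le), add_zero]
    · subst h; rw [if_neg (lt_irrefl _), add_zero, h0]
    · rw [if_neg (not_lt.2 h.le), if_pos h, zero_add]
  have hswap : (∑ μ, ∑ ν, if ν < μ then g μ ν else 0) = ∑ μ, ∑ ν, if μ < ν then g μ ν else 0 := by
    rw [sum_comm]
    exact sum_congr rfl fun ν _ => sum_congr rfl fun μ _ => by rw [hs μ ν]
  rw [hsplit, hswap]
  ring

/-- **Σ_{p⊂T}|(∂₁(lift B))(p)|² = ⟨∂₁B, ∂₁B⟩ of (1.66)** (`B5Bounds167Lattice.d1Sq`): the once-each plaquette sum of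
`B6Lemma24Torus.d1SqT` over the torus equals B5's ½Σ_{μ,ν}Σ_{x∈T}|(∂¹_μB_ν − ∂¹_νB_μ)(x)|².
[cite: Balaban1984PropagatorsI, (1.66) p.29; Balaban1984PropagatorsII, (2.118) p.243; dictionary] -/
theorem d1SqT_lift (B : Tor M × Fin d → ℝ) :
    d1SqT M (lift M B) = B5Bounds167Lattice.d1Sq M (ofRealCfg M B) := by
  set g : Fin d → Fin d → ℝ := fun j μ => ∑ t : Tor M, ‖B5Bounds167Lattice.curl M (ofRealCfg M B) j μ t‖ ^ 2
    with hg
  have hanti : ∀ (j μ : Fin d) (t : Tor M),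
      B5Bounds167Lattice.curl M (ofRealCfg M B) j μ t = -B5Bounds167Lattice.curl M (ofRealCfg M B) μ j t := by
    intro j μ t
    simp only [B5Bounds167Lattice.curl]
    ring
  have hs : ∀ j μ, g j μ = g μ j := fun j μ =>
    sum_congr rfl fun t _ => by rw [hanti j μ t, norm_neg]
  have h0 : ∀ μ, g μ μ = 0 := fun μ => by
    simp only [hg, B5Bounds167Lattice.curl, sub_self, norm_zero]
    simp
  have hL : d1SqT M (lift M B) = ∑ j, ∑ μ, if j < μ then g j μ else 0 := by
    unfold B6Lemma24Torus.d1SqT B6Lemma24Torus.plaqT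
    rw [sum_filter, sum_product, sum_comm, sum_product]
    refine sum_congr rfl fun j _ => sum_congr rfl fun μ _ => ?_
    by_cases h : j < μ
    · simp only [if_pos h, hg]
      rw [← sum_pbox_toT M]
      exact sum_congr rfl fun x _ => (norm_sq_curl_lift M B x j μ).symm
    · simp only [if_neg h, sum_const_zero]
  rw [hL, B5Bounds167Lattice.d1Sq, ← half_sum_offDiag g hs h0]

/-- **‖lift B‖²_T = Σ_{x∈T} Σ_ν B_ν(x)²**. [cite: Balaban1984PropagatorsII, (2.153) p.249; dictionary] -/
theorem normSqT_lift (B : Tor M × Fin d → ℝ) : normSqT M (lift M B) = ∑ t : Tor M, ∑ ν, B (t, ν) ^ 2 := by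
  unfold B6Lemma24Torus.normSqT B6Lemma24Torus.bondsT
  rw [sum_product]
  exact sum_pbox_toT M fun t => ∑ ν, B (t, ν) ^ 2

/-- NeZero periods are positive (the hypothesis shape of `B6Lemma24Torus`). [folklore] -/
theorem pos_of_neZero : ∀ i, 0 < M i := fun i => Nat.pos_of_ne_zero (NeZero.ne (M i))

/-! ## §4  (2.153) on the whole torus for the (1.66) form -/

/-- **(2.153) on the whole lattice T^{(k)}, concrete form.**  Let d ≥ 2, L ≥ 1, n ≥ 1, and let T = `Tor M` be a
torus whose periods are multiples of L.  For every real vector field B on T *"satisfying: QB = 0,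
B(Γ_{y,x}) = 0 for x ∈ B(y)"* — the tree gauge (2.121) on the blocks B(y), y ∈ T′, and (Q₁B)(c) = 0 at every
coarse bond c of T (Q₁ verbatim from (2.125)), both stated on the periodic extension `lift M B` — one has
((4/π²)^{d+2}/(12d²)) L^{−d−1} ‖B‖² ≤ ⟨B, Δ_kB⟩, the right side being the THIRD EXPRESSION of (1.66)
(`B5Bounds167Lattice.formDk n M`).  Proof = the print's: (2.128) on T (`B6Lemma24Torus.lemma24_torus`) with the
Q₁-term killed, then (2.118) = (1.67) (`B5Bounds167Lattice.ineq167`), through the dictionary of §3.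
[cite: Balaban1984PropagatorsII, (2.153) p.249, (2.118) p.243; Balaban1984PropagatorsI, (1.67) p.29] -/
theorem lowerBound2153_lattice (hd : 2 ≤ d) {L : ℕ} (hL : 1 ≤ L) (n : ℕ) (hn : 1 ≤ n) (hLM : ∀ i, L ∣ M i)
    (B : Tor M × Fin d → ℝ)
    (hT : ∀ y ∈ coarseSites L M, ∀ b ∈ treeBonds L y, lift M B b = 0)
    (hQ : ∀ c ∈ faces L M, q1 L (lift M B) c = 0) :
    (4 / Real.pi ^ 2) ^ (d + 2) / (12 * (d : ℝ) ^ 2) * (L : ℝ) ^ (-((d : ℝ) + 1)) * ∑ t : Tor M, ∑ ν, B (t, ν) ^ 2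
      ≤ formDk n M (ofRealCfg M B) := by
  haveI : NeZero n := ⟨by omega⟩
  have h24 := lemma24_torus hd hL (pos_of_neZero M) hLM (lift M B) (isPeriodic_lift M B) hT
  have hq : q1SqT L M (lift M B) = 0 := sum_eq_zero fun c hc => by rw [hQ c hc]; ring
  rw [hq, mul_zero, zero_add, d1SqT_lift, normSqT_lift] at h24
  have h167 := (ineq167 n M hn (ofRealCfg M B)).1
  have hγ : (0 : ℝ) ≤ (4 / Real.pi ^ 2) ^ (d + 2) := by positivity
  calc (4 / Real.pi ^ 2) ^ (d + 2) / (12 * (d : ℝ) ^ 2) * (L : ℝ) ^ (-((d : ℝ) + 1)) * ∑ t : Tor M, ∑ ν, B (t, ν) ^ 2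
      = (4 / Real.pi ^ 2) ^ (d + 2)
          * (1 / (12 * (d : ℝ) ^ 2) * (L : ℝ) ^ (-((d : ℝ) + 1)) * ∑ t : Tor M, ∑ ν, B (t, ν) ^ 2) := by ring
    _ ≤ (4 / Real.pi ^ 2) ^ (d + 2) * B5Bounds167Lattice.d1Sq M (ofRealCfg M B) :=
          mul_le_mul_of_nonneg_left h24 hγ
    _ ≤ formDk n M (ofRealCfg M B) := h167

/-- The same with (2.121) in its printed contour form: B(Γ_{y,x}) = 0 for x ∈ B(y), y ∈ T′
(`B6Lemma24PrintedShape.contourSum`). [cite: Balaban1984PropagatorsII, (2.153) p.249, (2.121) p.244] -/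
theorem lowerBound2153_lattice_contour (hd : 2 ≤ d) {L : ℕ} (hL : 1 ≤ L) (n : ℕ) (hn : 1 ≤ n)
    (hLM : ∀ i, L ∣ M i) (B : Tor M × Fin d → ℝ)
    (hAx : ∀ y ∈ coarseSites L M, ∀ x ∈ B6Elimination.block L y, contourSum L (lift M B) y x = 0)
    (hQ : ∀ c ∈ faces L M, q1 L (lift M B) c = 0) :
    (4 / Real.pi ^ 2) ^ (d + 2) / (12 * (d : ℝ) ^ 2) * (L : ℝ) ^ (-((d : ℝ) + 1)) * ∑ t : Tor M, ∑ ν, B (t, ν) ^ 2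
      ≤ formDk n M (ofRealCfg M B) :=
  lowerBound2153_lattice M hd hL n hn hLM B (fun y hy => treeGauge_of_contour (hAx y hy)) hQ

/-! ## §5  The typed node `B6.LowerBound2153` for the torus carriers, (2.118) discharged -/

/-- ⟨B, Δ_kB⟩ of a configuration on the torus T (an M-periodic `Cfg d`), as the (1.66) form of the vector field it
defines on `Tor M`. [cite: Balaban1984PropagatorsI, (1.66) p.29; dictionary] -/
def formT (n : ℕ) (M : Fin d → ℕ) [∀ μ, NeZero (M μ)] (B : Cfg d) : ℝ := formDk n M (ofRealCfg M (restrict M B))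

/-- **(2.118) for the torus carriers is a theorem**: γ₀ Σ_{p⊂T}|(∂₁B)(p)|² ≤ ⟨B, Δ_kB⟩_(1.66) for every
configuration B on T, γ₀ = (4/π²)^{d+2} — `B5Bounds167Lattice.ineq167` through the dictionary.
[cite: Balaban1984PropagatorsII, (2.118) p.243; Balaban1984PropagatorsI, (1.67) p.29] -/
theorem formT_ge (n : ℕ) (hn : 1 ≤ n) {B : Cfg d} (hB : IsPeriodic M B) :
    (4 / Real.pi ^ 2) ^ (d + 2) * d1SqT M B ≤ formT n M B := by
  haveI : NeZero n := ⟨by omega⟩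
  have h := (ineq167 n M hn (ofRealCfg M (restrict M B))).1
  rw [← d1SqT_lift, lift_restrict M hB] at h
  exact h

/-- **The typed node (2.153) for the torus carriers with the concrete form, NO (2.118) hypothesis**: for every
d ≥ 2, L ≥ 1, every family of steps n_i ≥ 1 and tori M_i (NeZero periods, L ∣ M_i μ), and any constraint `QZero`
killing the Q₁-term, `B6.LowerBound2153 d L γ₀ (torus carriers) (⟨·, Δ_k·⟩_(1.66)) QZero` with γ₀ = (4/π²)^{d+2}.
[cite: Balaban1984PropagatorsII, (2.153) p.249; Balaban1984PropagatorsI, (1.67) p.29] -/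
theorem lowerBound2153_torusCarrier {I : Type} (hd : 2 ≤ d) {L : ℕ} (hL : 1 ≤ L) (n : I → ℕ)
    (hn : ∀ i, 1 ≤ n i) (M : I → Fin d → ℕ) [∀ i μ, NeZero (M i μ)] (hLM : ∀ i μ, L ∣ M i μ)
    (QZero : I → Cfg d → Prop) (hQ : ∀ i B, QZero i B → q1SqT L (M i) B = 0) :
    LowerBound2153 d (L : ℝ) ((4 / Real.pi ^ 2) ^ (d + 2)) (fun i => torusCarrier L (M i))
      (fun i B => formT (n i) (M i) B) QZero := by
  intro i B hTG hQ0
  show (4 / Real.pi ^ 2) ^ (d + 2) / (12 * (d : ℝ) ^ 2) * (L : ℝ) ^ (-((d : ℝ) + 1)) * normSqT (M i) B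
    ≤ formT (n i) (M i) B
  have h24 := lemma24_torus hd hL (pos_of_neZero (M i)) (hLM i) B hTG.1 hTG.2
  rw [hQ i B hQ0, mul_zero, zero_add] at h24
  have hγ : (0 : ℝ) ≤ (4 / Real.pi ^ 2) ^ (d + 2) := by positivity
  calc (4 / Real.pi ^ 2) ^ (d + 2) / (12 * (d : ℝ) ^ 2) * (L : ℝ) ^ (-((d : ℝ) + 1)) * normSqT (M i) B
      = (4 / Real.pi ^ 2) ^ (d + 2) * (1 / (12 * (d : ℝ) ^ 2) * (L : ℝ) ^ (-((d : ℝ) + 1)) * normSqT (M i) B) := by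
        ring
    _ ≤ (4 / Real.pi ^ 2) ^ (d + 2) * d1SqT (M i) B := mul_le_mul_of_nonneg_left h24 hγ
    _ ≤ formT (n i) (M i) B := formT_ge (M i) (n i) (hn i) hTG.1

/-- The node with *"QB = 0"* read verbatim: (Q₁B)(c) = 0 at every coarse bond c of T, Q₁ from (2.125).
[cite: Balaban1984PropagatorsII, (2.153) p.249, (2.125) p.245] -/
theorem lowerBound2153_torusCarrier_faces {I : Type} (hd : 2 ≤ d) {L : ℕ} (hL : 1 ≤ L) (n : I → ℕ)
    (hn : ∀ i, 1 ≤ n i) (M : I → Fin d → ℕ) [∀ i μ, NeZero (M i μ)] (hLM : ∀ i μ, L ∣ M i μ) :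
    LowerBound2153 d (L : ℝ) ((4 / Real.pi ^ 2) ^ (d + 2)) (fun i => torusCarrier L (M i))
      (fun i B => formT (n i) (M i) B) (fun i B => ∀ c ∈ faces L (M i), q1 L B c = 0) :=
  lowerBound2153_torusCarrier hd hL n hn M hLM _ fun _ B hB => sum_eq_zero fun c hc => by rw [hB c hc]; ring

/-- The node with *"QB = 0"* read as the B5 (1.8) three-contour averages B_c = 0 (equal to Q₁ in the gauge (2.121)
on T, `B6Lemma24Torus.q18_eq_q1_torus`). [cite: Balaban1984PropagatorsII, (2.153) p.249; Balaban1984PropagatorsI, (1.8) p.19] -/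
theorem lowerBound2153_torusCarrier_faces18 {I : Type} (hd : 2 ≤ d) {L : ℕ} (hL : 1 ≤ L) (n : I → ℕ)
    (hn : ∀ i, 1 ≤ n i) (M : I → Fin d → ℕ) [∀ i μ, NeZero (M i μ)] (hLM : ∀ i μ, L ∣ M i μ) :
    LowerBound2153 d (L : ℝ) ((4 / Real.pi ^ 2) ^ (d + 2)) (fun i => torusCarrier L (M i))
      (fun i B => formT (n i) (M i) B) (fun i B => ∀ c ∈ faces L (M i), q18 L B c = 0) := by
  intro i B hTG hQ0
  refine lowerBound2153_torusCarrier_faces hd hL n hn M hLM i B hTG fun c hc => ?_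
  rw [← q18_eq_q1_torus (pos_of_neZero (M i)) (hLM i) hTG.1 hTG.2 hc]
  exact hQ0 c hc

/-! ## §6  (v1.1) The torus carriers on B5's own configuration type `Tor M × Fin d → ℝ` -/

/-- **Lemma 2.4's tree data on B5's configuration type**: configurations = real vector fields on `Tor M` (the
configuration type of `B5Bounds167Lattice.formOfLatticeR n M`); TreeGauge B = (2.121) on the blocks B(y), y ∈ T′, for
the periodic extension `lift M B`; q1Sq = Σ_{c∈T′}|(Q₁(lift B))(c)|² (Q₁ verbatim, (2.125)); d1Sq = B5's ⟨∂₁B, ∂₁B⟩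
(`B5Bounds167Lattice.d1Sq`, = Σ_{p⊂T}|(∂₁B)(p)|² by `d1SqT_lift`); normSq = Σ_x Σ_ν B(x,ν)² (= ‖B‖²_T by `normSqT_lift`).
[cite: Balaban1984PropagatorsII, Lemma 2.4 p.245 / (2.153) p.249; Balaban1984PropagatorsI, (1.66) p.29; dictionary] -/
def torCarrier (L : ℕ) (M : Fin d → ℕ) [∀ μ, NeZero (M μ)] : TreeData where
  Cfg := Tor M × Fin d → ℝ
  TreeGauge := fun B => ∀ y ∈ coarseSites L M, ∀ b ∈ treeBonds L y, lift M B b = 0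
  q1Sq := fun B => q1SqT L M (lift M B)
  d1Sq := fun B => B5Bounds167Lattice.d1Sq M (ofRealCfg M B)
  normSq := fun B => ∑ t : Tor M, ∑ ν, B (t, ν) ^ 2

/-- The configuration type of `torCarrier L M` IS that of B5's real form carrier `formOfLatticeR n M` (`rfl`). [folklore] -/
theorem torCarrier_cfg (L n : ℕ) : (torCarrier L M).Cfg = (B5Bounds167Lattice.formOfLatticeR n M).Cfg := rfl

/-- The `d1Sq` of `torCarrier L M` IS the `d1Sq` of `formOfLatticeR n M` (`rfl`): (2.118)'s ‖∂₁B‖² and (1.67)'s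
⟨∂₁B, ∂₁B⟩ are the same term. [folklore] -/
theorem torCarrier_d1Sq (L n : ℕ) (B : Tor M × Fin d → ℝ) :
    (torCarrier L M).d1Sq B = (B5Bounds167Lattice.formOfLatticeR n M).d1Sq B := rfl

/-- **`B6.Lemma24Printed` for the carriers on B5's configuration type** (every d ≥ 2, L ≥ 1, every family of tori
with NeZero periods divisible by L) — `B6Lemma24Torus.lemma24_torus` through `d1SqT_lift` / `normSqT_lift`.
[cite: Balaban1984PropagatorsII, Lemma 2.4 (2.128) p.245; (2.153) p.249] -/
theorem lemma24Printed_tor {I : Type} (hd : 2 ≤ d) {L : ℕ} (hL : 1 ≤ L) (M : I → Fin d → ℕ)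
    [∀ i μ, NeZero (M i μ)] (hLM : ∀ i μ, L ∣ M i μ) :
    B6.Lemma24Printed d (L : ℝ) (fun i => torCarrier L (M i)) := by
  intro i B hT
  show 1 / (12 * (d : ℝ) ^ 2) * (L : ℝ) ^ (-((d : ℝ) + 1)) * ∑ t : Tor (M i), ∑ ν, B (t, ν) ^ 2
    ≤ (L : ℝ) ^ ((d : ℝ) - 2) * q1SqT L (M i) (lift (M i) B) + B5Bounds167Lattice.d1Sq (M i) (ofRealCfg (M i) B)
  have h := lemma24_torus hd hL (pos_of_neZero (M i)) (hLM i) (lift (M i) B) (isPeriodic_lift (M i) B) hT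
  rwa [d1SqT_lift, normSqT_lift] at h

/-- **`B6.LowerBound2153` for the carriers on B5's configuration type with B5's OWN form `(formOfLatticeR n M).formΔk`**
(= `formDk n M ∘ ofRealCfg M`, the third expression of (1.66)), γ₀ = (4/π²)^{d+2}, any `QZero` killing the Q₁-term:
here (2.118) holds for EVERY configuration of the carrier (`B5Bounds167Lattice.ineq167`), so
`B6.lowerBound2153_of_lemma24` applies verbatim to `lemma24Printed_tor`.
[cite: Balaban1984PropagatorsII, (2.153) p.249, (2.118) p.243; Balaban1984PropagatorsI, (1.67) p.29] -/
theorem lowerBound2153_tor {I : Type} (hd : 2 ≤ d) {L : ℕ} (hL : 1 ≤ L) (n : I → ℕ) (hn : ∀ i, 1 ≤ n i)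
    (M : I → Fin d → ℕ) [∀ i μ, NeZero (M i μ)] (hLM : ∀ i μ, L ∣ M i μ)
    (QZero : ∀ i, (Tor (M i) × Fin d → ℝ) → Prop)
    (hQ : ∀ i B, QZero i B → q1SqT L (M i) (lift (M i) B) = 0) :
    LowerBound2153 d (L : ℝ) ((4 / Real.pi ^ 2) ^ (d + 2)) (fun i => torCarrier L (M i))
      (fun i B => (B5Bounds167Lattice.formOfLatticeR (n i) (M i)).formΔk B) QZero :=
  B6.lowerBound2153_of_lemma24 d (L : ℝ) ((4 / Real.pi ^ 2) ^ (d + 2)) (by positivity)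
    (fun i => torCarrier L (M i)) (fun i B => (B5Bounds167Lattice.formOfLatticeR (n i) (M i)).formΔk B) QZero
    (lemma24Printed_tor hd hL M hLM) hQ fun i B => by
      haveI : NeZero (n i) := ⟨by have := hn i; omega⟩
      exact (ineq167 (n i) (M i) (hn i) (ofRealCfg (M i) B)).1

/-- The node with *"QB = 0"* read verbatim ((Q₁(lift B))(c) = 0 at every coarse bond c of T).
[cite: Balaban1984PropagatorsII, (2.153) p.249, (2.125) p.245] -/
theorem lowerBound2153_tor_faces {I : Type} (hd : 2 ≤ d) {L : ℕ} (hL : 1 ≤ L) (n : I → ℕ) (hn : ∀ i, 1 ≤ n i)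
    (M : I → Fin d → ℕ) [∀ i μ, NeZero (M i μ)] (hLM : ∀ i μ, L ∣ M i μ) :
    LowerBound2153 d (L : ℝ) ((4 / Real.pi ^ 2) ^ (d + 2)) (fun i => torCarrier L (M i))
      (fun i B => (B5Bounds167Lattice.formOfLatticeR (n i) (M i)).formΔk B)
      (fun i B => ∀ c ∈ faces L (M i), q1 L (lift (M i) B) c = 0) :=
  lowerBound2153_tor hd hL n hn M hLM _ fun _ B hB => sum_eq_zero fun c hc => by rw [hB c hc]; ring

/-! ## §7  (v1.2) *"or on a subset Λ ⊂ T^{(k)}"* — the second case of the p. 249 passage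

p. 249 applies (2.128) to the integral (2.152) *"on the whole lattice T^{(k)}, or on a subset Λ ⊂ T^{(k)}"*; the
variables of the Λ-integral are B↾Λ ((2.154): *"∫dB↾_Λ δ(QB) δ_{Ax}(B) e^{−½⟨B,Δ_kB⟩+⟨J,B⟩}"*).  READING (HONEST
SCOPE (ii)): Λ = B(Λ′₀), Λ′₀ a set of coarse sites of T; B a configuration on T with B = 0 outside Λ in Lemma 2.4's
bond convention (p. 245: *"We denote by Λ also a set of bonds b such that at least one of the end-points b₋, b₊
belongs to Λ. … We put B = 0 outside Λ."*), the form being the same torus form; constraints (2.121) for y ∈ Λ′₀ and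
(Q₁B)(c) = 0 on the coarse bonds of T with an end-point in Λ′₀.  Under this reading the Λ-case is a COROLLARY of the
T-case: the blocks B(y), y ∈ T′ ∖ Λ′₀, are automatically in the gauge (2.121) (their tree bonds have both end-points
in B(y) ⊂ T ∖ Λ) and (Q₁B)(c) = 0 automatically on the coarse bonds not meeting Λ′₀ (every unit bond of the straight
contours [x, x + Le_μ], x ∈ B(c₋), has both end-points in B(c₋) ∪ B(c₊)). -/

open B6Elimination (corner corner_eq_of_mem_block corner_eq_self_of_dvd)
open B6Lemma24PrintedShape (segSum)
open B6Lemma24Torus (wrap wrap_eq_self wrap_mem_pbox wrap_mem_coarseSites coarseSites_dvd mem_coarseSites mem_faces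
  block_subset_pbox)

omit hM in
/-- **x ∈ Λ modulo the periods**: the site x of Z^d lies, as a point of the torus T (through its box representative
`wrap M x`), in Λ = B(Λ′₀) = ⋃_{y∈Λ′₀} B(y) — the corner (B5 (1.6)) of its representative is in Λ′₀.
[cite: Balaban1984PropagatorsII, Lemma 2.4 p.245 *"Λ = B(Λ′)"*; dictionary] -/
def InLam (L : ℕ) (M : Fin d → ℕ) (Λ'₀ : Finset (Fin d → ℤ)) (x : Fin d → ℤ) : Prop := corner L (wrap M x) ∈ Λ'₀

omit hM in
/-- **The coarse bonds of T with at least one end-point in Λ′₀** (c₋ = y or c₊ = y + Le_μ, modulo the periods):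
Lemma 2.4's *"c ∈ Λ′"* on the torus. [cite: Balaban1984PropagatorsII, Lemma 2.4 (2.128) p.245; dictionary] -/
def facesOf (L : ℕ) (M : Fin d → ℕ) (Λ'₀ : Finset (Fin d → ℤ)) : Finset ((Fin d → ℤ) × Fin d) :=
  (faces L M).filter fun c =>
    corner L (wrap M c.1) ∈ Λ'₀ ∨ corner L (wrap M (c.1 + (L : ℤ) • unitVec c.2)) ∈ Λ'₀

omit hM in
/-- Membership in `facesOf`. [folklore] -/
theorem mem_facesOf {L : ℕ} {Λ'₀ : Finset (Fin d → ℤ)} {c : (Fin d → ℤ) × Fin d} :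
    c ∈ facesOf L M Λ'₀ ↔ c ∈ faces L M ∧ (InLam L M Λ'₀ c.1 ∨ InLam L M Λ'₀ (c.1 + (L : ℤ) • unitVec c.2)) := by
  simp only [facesOf, InLam, mem_filter]

omit hM in
/-- (y + r) mod M = (y mod M) + r for an L-lattice coordinate y and 0 ≤ r < L, L ∣ M: blocks of LZ^d wrap onto blocks
of T′ rigidly. [folklore] -/
theorem emod_add_of_dvd {L Mi : ℕ} (hMi : 0 < Mi) (hLM : L ∣ Mi) {y r : ℤ} (hy : (L : ℤ) ∣ y) (hr0 : 0 ≤ r)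
    (hrL : r < (L : ℤ)) : (y + r) % (Mi : ℤ) = y % (Mi : ℤ) + r := by
  have hM0 : (0 : ℤ) < (Mi : ℤ) := by exact_mod_cast hMi
  have hdM : (L : ℤ) ∣ (Mi : ℤ) := Int.natCast_dvd_natCast.2 hLM
  have h1 : (L : ℤ) ∣ y % (Mi : ℤ) := by
    have e : y % (Mi : ℤ) = y - (Mi : ℤ) * (y / (Mi : ℤ)) := by
      have h := Int.mul_ediv_add_emod y (Mi : ℤ); linarith
    rw [e]; exact dvd_sub hy (dvd_mul_of_dvd_left hdM _)
  have h2 : y % (Mi : ℤ) < (Mi : ℤ) := Int.emod_lt_of_pos _ hM0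
  have h3 : (L : ℤ) ≤ (Mi : ℤ) - y % (Mi : ℤ) := Int.le_of_dvd (by omega) (dvd_sub hdM h1)
  have h4 : 0 ≤ y % (Mi : ℤ) := Int.emod_nonneg _ hM0.ne'
  have e2 : y + r = (y % (Mi : ℤ) + r) + (Mi : ℤ) * (y / (Mi : ℤ)) := by
    have h := Int.mul_ediv_add_emod y (Mi : ℤ); linarith
  rw [e2, Int.add_mul_emod_self_left, Int.emod_eq_of_lt (by omega) (by omega)]

omit hM in
/-- **Blocks wrap onto blocks**: for y′ ∈ LZ^d and z ∈ B(y′), the representative of z lies in the block of the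
representative of y′ (a coarse site of T). [folklore] -/
theorem wrap_mem_block {L : ℕ} (hM0 : ∀ i, 0 < M i) (hLM : ∀ i, L ∣ M i) {y' z : Fin d → ℤ}
    (hy' : ∀ i, (L : ℤ) ∣ y' i) (hz : z ∈ B6Elimination.block L y') :
    wrap M z ∈ B6Elimination.block L (wrap M y') := by
  refine B6Elimination.mem_block.2 fun i => ?_
  obtain ⟨h1, h2⟩ := B6Elimination.mem_block.1 hz i
  have e : z i = y' i + (z i - y' i) := by ring
  have key : wrap M z i = wrap M y' i + (z i - y' i) := by
    show z i % (M i : ℤ) = y' i % (M i : ℤ) + (z i - y' i)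
    rw [e, emod_add_of_dvd (hM0 i) (hLM i) (hy' i) (by omega) (by omega)]; ring
  exact ⟨by rw [key]; omega, by rw [key]; omega⟩

omit hM in
/-- **Λ-membership is constant on blocks, through the wrapping**: z ∈ B(y′), y′ ∈ LZ^d ⟹ (z ∈ Λ mod M ⟺ y′ ∈ Λ mod M).
[folklore] -/
theorem inLam_iff_of_mem_block {L : ℕ} (hL : 0 < L) (hM0 : ∀ i, 0 < M i) (hLM : ∀ i, L ∣ M i)
    {Λ'₀ : Finset (Fin d → ℤ)} {y' z : Fin d → ℤ} (hy' : ∀ i, (L : ℤ) ∣ y' i) (hz : z ∈ B6Elimination.block L y') :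
    InLam L M Λ'₀ z ↔ InLam L M Λ'₀ y' := by
  have hw : wrap M y' ∈ coarseSites L M := wrap_mem_coarseSites hM0 hLM hy'
  have hdv : ∀ i, (L : ℤ) ∣ wrap M y' i := coarseSites_dvd _ hw
  have e1 : corner L (wrap M y') = wrap M y' := corner_eq_self_of_dvd _ hdv
  have hz' : wrap M z ∈ B6Elimination.block L (corner L (wrap M y')) := by
    rw [e1]; exact wrap_mem_block M hM0 hLM hy' hz
  unfold InLam
  rw [corner_eq_of_mem_block hL hz']

omit hM in
/-- Coordinates of x + t e_μ. [folklore] -/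
theorem add_smul_unitVec_apply' (x : Fin d → ℤ) (t : ℤ) (μ i : Fin d) :
    (x + t • unitVec μ) i = x i + if i = μ then t else 0 := by
  simp only [Pi.add_apply, Pi.smul_apply, unitVec_apply, smul_eq_mul, mul_ite, mul_one, mul_zero]

omit hM in
/-- **A point of the straight contour [x, x + Le_μ], x ∈ B(y), is outside Λ (mod M) when neither y nor y + Le_μ is in
Λ (mod M)**: x + te_μ (0 ≤ t ≤ L) lies in B(y) or in B(y + Le_μ). [folklore] -/
theorem not_inLam_segment {L : ℕ} (hL : 0 < L) (hM0 : ∀ i, 0 < M i) (hLM : ∀ i, L ∣ M i)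
    {Λ'₀ : Finset (Fin d → ℤ)} {y x : Fin d → ℤ} (hy : ∀ i, (L : ℤ) ∣ y i) (hx : x ∈ B6Elimination.block L y)
    {μ : Fin d}
    (h1 : ¬ InLam L M Λ'₀ y) (h2 : ¬ InLam L M Λ'₀ (y + (L : ℤ) • unitVec μ)) {t : ℤ} (ht0 : 0 ≤ t)
    (htL : t ≤ (L : ℤ)) : ¬ InLam L M Λ'₀ (x + t • unitVec μ) := by
  have hxy := B6Elimination.mem_block.1 hx
  by_cases hlt : x μ + t < y μ + (L : ℤ)
  · -- the point lies in B(y)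
    have hz : x + t • unitVec μ ∈ B6Elimination.block L y := B6Elimination.mem_block.2 fun i => by
      rw [add_smul_unitVec_apply']
      obtain ⟨a, b⟩ := hxy i
      by_cases hi : i = μ
      · subst hi; simp only [if_true]; exact ⟨by omega, hlt⟩
      · simp only [if_neg hi, add_zero]; exact ⟨a, b⟩
    rwa [inLam_iff_of_mem_block M hL hM0 hLM hy hz]
  · -- the point lies in B(y + Le_μ)
    have hy2 : ∀ i, (L : ℤ) ∣ (y + (L : ℤ) • unitVec μ) i := fun i => by
      rw [add_smul_unitVec_apply']
      by_cases hi : i = μ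
      · simp only [hi, if_true]; exact dvd_add (hy μ) (dvd_refl _)
      · simp only [if_neg hi, add_zero]; exact hy i
    have hz : x + t • unitVec μ ∈ B6Elimination.block L (y + (L : ℤ) • unitVec μ) :=
      B6Elimination.mem_block.2 fun i => by
        rw [add_smul_unitVec_apply', add_smul_unitVec_apply']
        obtain ⟨a, b⟩ := hxy i
        by_cases hi : i = μ
        · subst hi; simp only [if_true]; exact ⟨by omega, by omega⟩
        · simp only [if_neg hi, add_zero]; exact ⟨a, b⟩
    rwa [inLam_iff_of_mem_block M hL hM0 hLM hy2 hz]

omit hM in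
/-- **Blocks outside Λ are in the gauge (2.121) automatically**: for y ∈ T′ not in Λ (mod M), every tree bond of B(y)
has both end-points in B(y), where B vanishes. [cite: Balaban1984PropagatorsII, (2.121) p.244, Lemma 2.4 p.245
*"We put B = 0 outside Λ"*; dictionary] -/
theorem treeGauge_of_not_inLam {L : ℕ} (hL : 0 < L) (hM0 : ∀ i, 0 < M i) (hLM : ∀ i, L ∣ M i)
    {Λ'₀ : Finset (Fin d → ℤ)} {B : Cfg d}
    (hsupp : ∀ (x : Fin d → ℤ) (ν : Fin d), ¬ InLam L M Λ'₀ x → ¬ InLam L M Λ'₀ (x + unitVec ν) → B (x, ν) = 0)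
    {y : Fin d → ℤ} (hy : y ∈ coarseSites L M) (hyΛ : ¬ InLam L M Λ'₀ y) :
    ∀ b ∈ treeBonds L y, B b = 0 := by
  rintro ⟨w, μ⟩ hb
  obtain ⟨hw, -, h3⟩ := B6BondElimination.mem_treeBonds.1 hb
  dsimp only at hw h3
  have hyd : ∀ i, (L : ℤ) ∣ y i := coarseSites_dvd _ hy
  have hw' : w + unitVec μ ∈ B6Elimination.block L y := B6Elimination.mem_block.2 fun i => by
    rw [Pi.add_apply, unitVec_apply]
    obtain ⟨a, b⟩ := B6Elimination.mem_block.1 hw i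
    by_cases hi : i = μ
    · subst hi; simp only [if_true]; exact ⟨by omega, by omega⟩
    · simp only [if_neg hi, add_zero]; exact ⟨a, b⟩
  exact hsupp w μ (by rwa [inLam_iff_of_mem_block M hL hM0 hLM hyd hw])
    (by rwa [inLam_iff_of_mem_block M hL hM0 hLM hyd hw'])

omit hM in
/-- **(Q₁B)(c) = 0 automatically on the coarse bonds not meeting Λ′₀**: every unit bond of the straight contours
[x, x + Le_μ], x ∈ B(c₋), of (2.125) has both end-points in B(c₋) ∪ B(c₊) ⊂ T ∖ Λ.
[cite: Balaban1984PropagatorsII, (2.125) p.245; dictionary] -/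
theorem q1_eq_zero_of_not_meeting {L : ℕ} (hL : 0 < L) (hM0 : ∀ i, 0 < M i) (hLM : ∀ i, L ∣ M i)
    {Λ'₀ : Finset (Fin d → ℤ)} {B : Cfg d}
    (hsupp : ∀ (x : Fin d → ℤ) (ν : Fin d), ¬ InLam L M Λ'₀ x → ¬ InLam L M Λ'₀ (x + unitVec ν) → B (x, ν) = 0)
    {c : (Fin d → ℤ) × Fin d} (hc : c ∈ faces L M) (h1 : ¬ InLam L M Λ'₀ c.1)
    (h2 : ¬ InLam L M Λ'₀ (c.1 + (L : ℤ) • unitVec c.2)) : q1 L B c = 0 := by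
  have hyd : ∀ i, (L : ℤ) ∣ c.1 i := coarseSites_dvd _ (mem_faces.1 hc)
  refine sum_eq_zero fun x hx => ?_
  have hseg : segSum L B x c.2 = 0 := by
    refine sum_eq_zero fun s hs => ?_
    have hsL : (s : ℤ) < (L : ℤ) := by exact_mod_cast mem_range.1 hs
    refine hsupp _ _ (not_inLam_segment M hL hM0 hLM hyd hx h1 h2 (by positivity) hsL.le) ?_
    have e : x + (s : ℤ) • unitVec c.2 + unitVec c.2 = x + ((s : ℤ) + 1) • unitVec c.2 := by
      rw [add_assoc, add_smul, one_smul]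
    rw [e]
    exact not_inLam_segment M hL hM0 hLM hyd hx h1 h2 (by positivity) (by omega)
  rw [hseg, mul_zero]

omit hM in
/-- For a coarse site y of the box, "y ∈ Λ (mod M)" is just y ∈ Λ′₀. [folklore] -/
theorem inLam_iff_mem {L : ℕ} {Λ'₀ : Finset (Fin d → ℤ)} {y : Fin d → ℤ} (hy : y ∈ coarseSites L M) :
    InLam L M Λ'₀ y ↔ y ∈ Λ'₀ := by
  unfold InLam
  rw [wrap_eq_self (mem_coarseSites.1 hy).1, corner_eq_self_of_dvd _ (coarseSites_dvd _ hy)]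

omit hM in
/-- **Lemma 2.4 (2.128) on the torus T for Λ = B(Λ′₀) ⊂ T** (printed constant 1/(12d²); d ≥ 2, L ≥ 1, periods
M_i ≥ 1 divisible by L; Λ′₀ any set of coarse sites): for an M-periodic configuration B with *"B = 0 outside Λ"*
(B(⟨x, x + e_ν⟩) = 0 unless x or x + e_ν lies in Λ modulo the periods) in the gauge (2.121) on the blocks B(y),
y ∈ Λ′₀:  (1/(12d²)) L^{−d−1} ‖B‖²_T ≤ L^{d−2} Σ_{c coarse bond of T meeting Λ′₀} |(Q₁B)(c)|² + Σ_{p⊂T} |(∂₁B)(p)|².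
COROLLARY of the whole-torus Lemma `B6Lemma24Torus.lemma24_torus`: the remaining blocks are in the gauge
automatically (`treeGauge_of_not_inLam`) and the remaining Q₁-terms vanish (`q1_eq_zero_of_not_meeting`).
[cite: Balaban1984PropagatorsII, Lemma 2.4 (2.128) p.245; p.249 *"or on a subset Λ ⊂ T^{(k)}"*] -/
theorem lemma24_torus_subset (hd : 2 ≤ d) {L : ℕ} (hL : 1 ≤ L) (hM0 : ∀ i, 0 < M i) (hLM : ∀ i, L ∣ M i)
    (Λ'₀ : Finset (Fin d → ℤ)) (B : Cfg d) (hB : IsPeriodic M B)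
    (hsupp : ∀ (x : Fin d → ℤ) (ν : Fin d), ¬ InLam L M Λ'₀ x → ¬ InLam L M Λ'₀ (x + unitVec ν) → B (x, ν) = 0)
    (hT : ∀ y ∈ Λ'₀, ∀ b ∈ treeBonds L y, B b = 0) :
    1 / (12 * (d : ℝ) ^ 2) * (L : ℝ) ^ (-((d : ℝ) + 1)) * normSqT M B ≤
      (L : ℝ) ^ ((d : ℝ) - 2) * ∑ c ∈ facesOf L M Λ'₀, q1 L B c ^ 2 + d1SqT M B := by
  have hL0 : 0 < L := hL
  have hT' : ∀ y ∈ coarseSites L M, ∀ b ∈ treeBonds L y, B b = 0 := fun y hy => by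
    by_cases hyΛ : InLam L M Λ'₀ y
    · exact hT y ((inLam_iff_mem M hy).1 hyΛ)
    · exact treeGauge_of_not_inLam M hL0 hM0 hLM hsupp hy hyΛ
  have h := lemma24_torus hd hL hM0 hLM B hB hT'
  have hq : q1SqT L M B = ∑ c ∈ facesOf L M Λ'₀, q1 L B c ^ 2 := by
    unfold q1SqT facesOf
    rw [sum_filter]
    refine sum_congr rfl fun c hc => ?_
    split_ifs with hcase
    · rfl
    · push Not at hcase
      rw [q1_eq_zero_of_not_meeting M hL0 hM0 hLM hsupp hc hcase.1 hcase.2]; ring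
  rwa [hq] at h

omit hM in
/-- rep (x mod M) is the box representative `wrap M x`. [folklore] -/
theorem rep_toT_eq_wrap [∀ μ, NeZero (M μ)] (x : Fin d → ℤ) : rep M (toT M x) = wrap M x := by
  ext i; simp only [rep, toT, ZMod.val_intCast]; rfl

/-- **(2.153) for Λ = B(Λ′₀) ⊂ T, concrete form.**  Let d ≥ 2, L ≥ 1, n ≥ 1, T = `Tor M` with periods divisible by
L, Λ′₀ a set of coarse sites and Λ = B(Λ′₀).  For every real vector field B on T with *"B = 0 outside Λ"*
(B_ν(x) = 0 unless x or x + e_ν lies in Λ, read on the box representatives `rep`), in the gauge (2.121) on the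
blocks B(y), y ∈ Λ′₀, and with (Q₁B)(c) = 0 on the coarse bonds c of T meeting Λ′₀ (both stated on the periodic
extension `lift M B`):  ((4/π²)^{d+2}/(12d²)) L^{−d−1} ‖B‖² ≤ ⟨B, Δ_kB⟩, the right side being the THIRD EXPRESSION
of (1.66) evaluated at B (the variables B↾Λ of (2.154)).  Proof = the print's: (2.128) (`lemma24_torus_subset`) with
the Q₁-term killed, then (2.118) = (1.67) (`B5Bounds167Lattice.ineq167`).
[cite: Balaban1984PropagatorsII, (2.153) p.249 *"or on a subset Λ ⊂ T^{(k)}"*, (2.118) p.243;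
Balaban1984PropagatorsI, (1.67) p.29] -/
theorem lowerBound2153_lattice_subset (hd : 2 ≤ d) {L : ℕ} (hL : 1 ≤ L) (n : ℕ) (hn : 1 ≤ n)
    (hLM : ∀ i, L ∣ M i) (Λ'₀ : Finset (Fin d → ℤ)) (B : Tor M × Fin d → ℝ)
    (hsupp : ∀ (t : Tor M) (ν : Fin d), corner L (rep M t) ∉ Λ'₀ →
      corner L (rep M (t + B5Prop11Plancherel.unitVec M ν)) ∉ Λ'₀ → B (t, ν) = 0)
    (hT : ∀ y ∈ Λ'₀, ∀ b ∈ treeBonds L y, lift M B b = 0)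
    (hQ : ∀ c ∈ facesOf L M Λ'₀, q1 L (lift M B) c = 0) :
    (4 / Real.pi ^ 2) ^ (d + 2) / (12 * (d : ℝ) ^ 2) * (L : ℝ) ^ (-((d : ℝ) + 1)) * ∑ t : Tor M, ∑ ν, B (t, ν) ^ 2
      ≤ formDk n M (ofRealCfg M B) := by
  haveI : NeZero n := ⟨by omega⟩
  have hsupp' : ∀ (x : Fin d → ℤ) (ν : Fin d), ¬ InLam L M Λ'₀ x → ¬ InLam L M Λ'₀ (x + unitVec ν) →
      lift M B (x, ν) = 0 := fun x ν h1 h2 => by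
    rw [lift_apply]
    refine hsupp _ _ ?_ ?_
    · rw [rep_toT_eq_wrap]; exact h1
    · rw [← toT_unitVec, ← toT_add, rep_toT_eq_wrap]; exact h2
  have h24 := lemma24_torus_subset M hd hL (pos_of_neZero M) hLM Λ'₀ (lift M B) (isPeriodic_lift M B) hsupp' hT
  have hq : ∑ c ∈ facesOf L M Λ'₀, q1 L (lift M B) c ^ 2 = 0 := sum_eq_zero fun c hc => by rw [hQ c hc]; ring
  rw [hq, mul_zero, zero_add, d1SqT_lift, normSqT_lift] at h24
  have h167 := (ineq167 n M hn (ofRealCfg M B)).1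
  have hγ : (0 : ℝ) ≤ (4 / Real.pi ^ 2) ^ (d + 2) := by positivity
  calc (4 / Real.pi ^ 2) ^ (d + 2) / (12 * (d : ℝ) ^ 2) * (L : ℝ) ^ (-((d : ℝ) + 1)) * ∑ t : Tor M, ∑ ν, B (t, ν) ^ 2
      = (4 / Real.pi ^ 2) ^ (d + 2)
          * (1 / (12 * (d : ℝ) ^ 2) * (L : ℝ) ^ (-((d : ℝ) + 1)) * ∑ t : Tor M, ∑ ν, B (t, ν) ^ 2) := by ring
    _ ≤ (4 / Real.pi ^ 2) ^ (d + 2) * B5Bounds167Lattice.d1Sq M (ofRealCfg M B) :=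
          mul_le_mul_of_nonneg_left h24 hγ
    _ ≤ formDk n M (ofRealCfg M B) := h167

/-- **Lemma 2.4's tree data for Λ = B(Λ′₀) ⊂ T on B5's configuration type**: configurations = real vector fields on
`Tor M`; TreeGauge B = (*"B = 0 outside Λ"* in the bond convention) ∧ ((2.121) on the blocks B(y), y ∈ Λ′₀, for
`lift M B`); q1Sq = Σ over the coarse bonds of T meeting Λ′₀ of |(Q₁(lift B))(c)|²; d1Sq = B5's ⟨∂₁B, ∂₁B⟩; normSq =
Σ_x Σ_ν B_ν(x)² (= ‖B‖² over the bonds meeting Λ, the others carrying B = 0).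
[cite: Balaban1984PropagatorsII, Lemma 2.4 p.245 / (2.153) p.249 *"or on a subset Λ ⊂ T^{(k)}"*; dictionary] -/
def torCarrierSub (L : ℕ) (M : Fin d → ℕ) [∀ μ, NeZero (M μ)] (Λ'₀ : Finset (Fin d → ℤ)) : TreeData where
  Cfg := Tor M × Fin d → ℝ
  TreeGauge := fun B =>
    (∀ (t : Tor M) (ν : Fin d), corner L (rep M t) ∉ Λ'₀ →
      corner L (rep M (t + B5Prop11Plancherel.unitVec M ν)) ∉ Λ'₀ → B (t, ν) = 0) ∧
    ∀ y ∈ Λ'₀, ∀ b ∈ treeBonds L y, lift M B b = 0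
  q1Sq := fun B => ∑ c ∈ facesOf L M Λ'₀, q1 L (lift M B) c ^ 2
  d1Sq := fun B => B5Bounds167Lattice.d1Sq M (ofRealCfg M B)
  normSq := fun B => ∑ t : Tor M, ∑ ν, B (t, ν) ^ 2

/-- **`B6.Lemma24Printed` for the Λ ⊂ T carriers** (family index i ↦ torus M i, region Λ′₀ = Λ i).
[cite: Balaban1984PropagatorsII, Lemma 2.4 (2.128) p.245; (2.153) p.249] -/
theorem lemma24Printed_torSub {I : Type} (hd : 2 ≤ d) {L : ℕ} (hL : 1 ≤ L) (M : I → Fin d → ℕ)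
    [∀ i μ, NeZero (M i μ)] (hLM : ∀ i μ, L ∣ M i μ) (Λ : I → Finset (Fin d → ℤ)) :
    B6.Lemma24Printed d (L : ℝ) (fun i => torCarrierSub L (M i) (Λ i)) := by
  intro i B hB
  show 1 / (12 * (d : ℝ) ^ 2) * (L : ℝ) ^ (-((d : ℝ) + 1)) * ∑ t : Tor (M i), ∑ ν, B (t, ν) ^ 2
    ≤ (L : ℝ) ^ ((d : ℝ) - 2) * ∑ c ∈ facesOf L (M i) (Λ i), q1 L (lift (M i) B) c ^ 2
      + B5Bounds167Lattice.d1Sq (M i) (ofRealCfg (M i) B)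
  have hsupp' : ∀ (x : Fin d → ℤ) (ν : Fin d), ¬ InLam L (M i) (Λ i) x → ¬ InLam L (M i) (Λ i) (x + unitVec ν) →
      lift (M i) B (x, ν) = 0 := fun x ν h1 h2 => by
    rw [lift_apply]
    refine hB.1 _ _ ?_ ?_
    · rw [rep_toT_eq_wrap]; exact h1
    · rw [← toT_unitVec, ← toT_add, rep_toT_eq_wrap]; exact h2
  have h := lemma24_torus_subset (M i) hd hL (pos_of_neZero (M i)) (hLM i) (Λ i) (lift (M i) B)
    (isPeriodic_lift (M i) B) hsupp' hB.2
  rwa [d1SqT_lift, normSqT_lift] at h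

/-- **`B6.LowerBound2153` for the Λ ⊂ T carriers with B5's own form** `(formOfLatticeR n M).formΔk` and
γ₀ = (4/π²)^{d+2}, for any `QZero` killing the Q₁-terms of the coarse bonds meeting Λ′₀: (2.118) holds for every
configuration of the carrier (`ineq167`), so `B6.lowerBound2153_of_lemma24` applies verbatim.
[cite: Balaban1984PropagatorsII, (2.153) p.249 *"or on a subset Λ ⊂ T^{(k)}"*, (2.118) p.243;
Balaban1984PropagatorsI, (1.67) p.29] -/
theorem lowerBound2153_torSub {I : Type} (hd : 2 ≤ d) {L : ℕ} (hL : 1 ≤ L) (n : I → ℕ) (hn : ∀ i, 1 ≤ n i)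
    (M : I → Fin d → ℕ) [∀ i μ, NeZero (M i μ)] (hLM : ∀ i μ, L ∣ M i μ) (Λ : I → Finset (Fin d → ℤ))
    (QZero : ∀ i, (Tor (M i) × Fin d → ℝ) → Prop)
    (hQ : ∀ i B, QZero i B → ∑ c ∈ facesOf L (M i) (Λ i), q1 L (lift (M i) B) c ^ 2 = 0) :
    LowerBound2153 d (L : ℝ) ((4 / Real.pi ^ 2) ^ (d + 2)) (fun i => torCarrierSub L (M i) (Λ i))
      (fun i B => (B5Bounds167Lattice.formOfLatticeR (n i) (M i)).formΔk B) QZero :=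
  B6.lowerBound2153_of_lemma24 d (L : ℝ) ((4 / Real.pi ^ 2) ^ (d + 2)) (by positivity)
    (fun i => torCarrierSub L (M i) (Λ i)) (fun i B => (B5Bounds167Lattice.formOfLatticeR (n i) (M i)).formΔk B)
    QZero (lemma24Printed_torSub hd hL M hLM Λ) hQ fun i B => by
      haveI : NeZero (n i) := ⟨by have := hn i; omega⟩
      exact (ineq167 (n i) (M i) (hn i) (ofRealCfg (M i) B)).1

/-- The node with *"QB = 0"* read verbatim on the coarse bonds meeting Λ′₀: (Q₁(lift B))(c) = 0 for c ∈ `facesOf`.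
[cite: Balaban1984PropagatorsII, (2.153) p.249, (2.125) p.245] -/
theorem lowerBound2153_torSub_faces {I : Type} (hd : 2 ≤ d) {L : ℕ} (hL : 1 ≤ L) (n : I → ℕ) (hn : ∀ i, 1 ≤ n i)
    (M : I → Fin d → ℕ) [∀ i μ, NeZero (M i μ)] (hLM : ∀ i μ, L ∣ M i μ) (Λ : I → Finset (Fin d → ℤ)) :
    LowerBound2153 d (L : ℝ) ((4 / Real.pi ^ 2) ^ (d + 2)) (fun i => torCarrierSub L (M i) (Λ i))
      (fun i B => (B5Bounds167Lattice.formOfLatticeR (n i) (M i)).formΔk B)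
      (fun i B => ∀ c ∈ facesOf L (M i) (Λ i), q1 L (lift (M i) B) c = 0) :=
  lowerBound2153_torSub hd hL n hn M hLM Λ _ fun _ B hB => sum_eq_zero fun c hc => by rw [hB c hc]; ring

omit hM in
/-- **Consistency with the whole-torus case**: for Λ′₀ ⊇ T′ (every block in Λ) the support condition is vacuous and
`facesOf` is all of the coarse bonds of T, so `lemma24_torus_subset` is `lemma24_torus` again. [folklore] -/
theorem facesOf_univ {L : ℕ} {Λ'₀ : Finset (Fin d → ℤ)} (hΛ : coarseSites L M ⊆ Λ'₀) :
    facesOf L M Λ'₀ = faces L M := by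
  refine filter_true_of_mem fun c hc => Or.inl (hΛ ?_)
  rw [wrap_eq_self (mem_coarseSites.1 (mem_faces.1 hc)).1, corner_eq_self_of_dvd _ (coarseSites_dvd _ (mem_faces.1 hc))]
  exact mem_faces.1 hc

end

end Literature.MathematicalPhysics.QuantumFieldTheory.Balaban1983to89.B6LowerBound2153Torus
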